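import Summits.AnomalousDissipation.AnomalousDissipation.Theses.TameDichotomy
import Literature.ModelTheory.ExponentialFields.OMinimalDefinability
import Literature.ModelTheory.ExponentialFields.OMinimalMonotonicityReal

/-!
# Birth skeleton (BC3) of the piece `TameEulerDissipator` (X₁ of the Euler-limit split of
`TameDichotomy.TameSteadyWitness`, crux-strategist stmt-AnomalousDissipation-2850, 2026-08-17)

Line "either sign will do": steady Euler with a steady force is invariant under the reflection
`ū ↦ −ū` (the momentum equation is quadratic in `ū`; the weak form
`∫ ⟪ū, (ū·∇)w⟫ + ∫ ⟪f, w⟫ = 0` is even in `ū`), which flips the sign of the absorbed power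
`∫ ⟪f, ū⟫`.  Hence a tame steady weak Euler state that is merely NON-CONSERVATIVE
(`∫ ⟪f, ū⟫ ≠ 0` — an energy SOURCE at the singular strata is as good as a sink) already yields a
tame Euler dissipator.

* `stub_nonconservative` (hardest; the whole open content): a tame steady weak Euler state with
  `∫ ⟪f, ū⟫ ≠ 0`.
* `stub_reflection` (true, S/M-sized: definability of the graph of `−ū` in an expansion of the
  ordered ring, `MemLp.neg`, linearity of `Torus.convect` in the transporting field): the reflected
  field `−ū` is again an `L`-definable `L²` weakly divergence-free steady weak Euler state for the
  SAME force.
* `TameEulerDissipator_of : Sig.stub_nonconservative → Sig.stub_reflection → TameEulerDissipator`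
  (real proof: case on the sign of the power; reflect in the negative case).
-/

set_option linter.dupNamespace false

noncomputable section

namespace Summit.AnomalousDissipation.AnomalousDissipation.Cruxes.TameSteadyWitness.BirthTameEulerDissipator

open scoped Topology InnerProductSpace
open Filter Set MeasureTheory
open Literature.Analysis.FunctionSpaces

/-- The piece `TameEulerDissipator` (X of this skeleton) — character-for-character the route child / the def in
`Cruxes/TameSteadyWitness/Lines/euler_limit_split_assembly.lean` (namespace-local copy so that this
file does not depend on that module's build). -/
def TameEulerDissipator : Prop :=
  ∃ f : UnitAddTorus (Fin 3) → EuclideanSpace ℝ (Fin 3), Literature.Analysis.FunctionSpaces.Torus.IsSmooth f ∧ Literature.Analysis.FunctionSpaces.Torus.IsDivFree f ∧ Literature.Analysis.FunctionSpaces.Torus.HasZeroMean f ∧ ∃ (L : FirstOrder.Language.{0, 0}) (_ : L.Structure ℝ) (φ : FirstOrder.Language.LHom Literature.ModelTheory.ExponentialFields.Language.orderedRing L) (_ : φ.IsExpansionOn ℝ), L.IsOMinimal ℝ ∧ ∃ ū : UnitAddTorus (Fin 3) → EuclideanSpace ℝ (Fin 3), (Set.univ : Set ℝ).Definable L {v :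 Fin 6 → ℝ | v 0 ∈ Set.Ico (0 : ℝ) 1 ∧ v 1 ∈ Set.Ico (0 : ℝ) 1 ∧ v 2 ∈ Set.Ico (0 : ℝ) 1 ∧ v 3 = ū (Literature.Analysis.FunctionSpaces.Torus.proj !₂[v 0, v 1, v 2]) 0 ∧ v 4 = ū (Literature.Analysis.FunctionSpaces.Torus.proj !₂[v 0, v 1, v 2]) 1 ∧ v 5 = ū (Literature.Analysis.FunctionSpaces.Torus.proj !₂[v 0, v 1, v 2]) 2} ∧ MeasureTheory.MemLp ū 2 MeasureTheory.volume ∧ Literature.Analysis.FunctionSpaces.Torus.IsWeaklyDivFree ū ∧ (∀ w : UnitAddTorus (Fin 3) → EuclideanSpace ℝ (Fin 3), Literature.Analysis.FunctionSpaces.Torus.IsSmooth w → Literature.Analysis.FunctionSpaces.Torus.IsDivFree w → ∫ x, inner ℝ (ū x) (Literature.Analysis.FunctionSpaces.Torus.convect ū w x) + ∫ x, inner ℝ (f x) (w x) = 0) ∧ 0 < ∫ x, inner ℝ (f x) (ū x)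

/-- Signature of `stub_nonconservative`: a TAME NON-CONSERVATIVE steady weak Euler state — the
clauses of `TameEulerDissipator` with the power condition weakened to `∫ ⟪f, ū⟫ ≠ 0`. -/
def Sig.stub_nonconservative : Prop :=
  ∃ f : UnitAddTorus (Fin 3) → EuclideanSpace ℝ (Fin 3), Literature.Analysis.FunctionSpaces.Torus.IsSmooth f ∧ Literature.Analysis.FunctionSpaces.Torus.IsDivFree f ∧ Literature.Analysis.FunctionSpaces.Torus.HasZeroMean f ∧ ∃ (L : FirstOrder.Language.{0, 0}) (_ : L.Structure ℝ) (φ : FirstOrder.Language.LHom Literature.ModelTheory.ExponentialFields.Language.orderedRing L) (_ : φ.IsExpansionOn ℝ), L.IsOMinimal ℝ ∧ ∃ ū : UnitAddTorus (Fin 3) → EuclideanSpace ℝ (Fin 3), (Set.univ : Set ℝ).Definable L {v : Fin 6 → ℝ | v 0 ∈ Set.Ico (0 : ℝ) 1 ∧ v 1 ∈ Set.Ico (0 : ℝ) 1 ∧ v 2 ∈ Set.Ico (0 : ℝ) 1 ∧ v 3 = ū (Literature.Analysis.FunctionSpaces.Torus.proj !₂[v 0, v 1, v 2]) 0 ∧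 v 4 = ū (Literature.Analysis.FunctionSpaces.Torus.proj !₂[v 0, v 1, v 2]) 1 ∧ v 5 = ū (Literature.Analysis.FunctionSpaces.Torus.proj !₂[v 0, v 1, v 2]) 2} ∧ MeasureTheory.MemLp ū 2 MeasureTheory.volume ∧ Literature.Analysis.FunctionSpaces.Torus.IsWeaklyDivFree ū ∧ (∀ w : UnitAddTorus (Fin 3) → EuclideanSpace ℝ (Fin 3), Literature.Analysis.FunctionSpaces.Torus.IsSmooth w → Literature.Analysis.FunctionSpaces.Torus.IsDivFree w → ∫ x, inner ℝ (ū x) (Literature.Analysis.FunctionSpaces.Torus.convect ū w x) + ∫ x, inner ℝ (f x) (w x) = 0) ∧ (∫ x, inner ℝ (f x) (ū x)) ≠ 0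

/-- Signature of `stub_reflection`: the reflection `ū ↦ −ū` preserves every clause of a tame steady
weak Euler state (definability in an expansion of the ordered ring, `L²`, weak divergence-freeness,
the weak Euler identity for the same force `f`). -/
def Sig.stub_reflection : Prop :=
  ∀ (L : FirstOrder.Language.{0, 0}) [L.Structure ℝ] (φ : FirstOrder.Language.LHom Literature.ModelTheory.ExponentialFields.Language.orderedRing L) [φ.IsExpansionOn ℝ], ∀ (f ū : UnitAddTorus (Fin 3) → EuclideanSpace ℝ (Fin 3)), (Set.univ : Set ℝ).Definable L {v : Fin 6 → ℝ | v 0 ∈ Set.Ico (0 : ℝ) 1 ∧ v 1 ∈ Set.Ico (0 : ℝ) 1 ∧ v 2 ∈ Set.Ico (0 : ℝ) 1 ∧ v 3 = ū (Literature.Analysis.FunctionSpaces.Torus.proj !₂[v 0, v 1, v 2]) 0 ∧ v 4 = ū (Literature.Analysis.FunctionSpaces.Torus.proj !₂[v 0, v 1, v 2]) 1 ∧ v 5 = ū (Literature.Analysis.FunctionSpaces.Torus.proj !₂[v 0, v 1, v 2]) 2} → MeasureTheory.MemLp ū 2 MeasureTheory.volume → Literature.Analysis.FunctionSpaces.Torus.IsWeaklyDivFree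 ū → (∀ w : UnitAddTorus (Fin 3) → EuclideanSpace ℝ (Fin 3), Literature.Analysis.FunctionSpaces.Torus.IsSmooth w → Literature.Analysis.FunctionSpaces.Torus.IsDivFree w → ∫ x, inner ℝ (ū x) (Literature.Analysis.FunctionSpaces.Torus.convect ū w x) + ∫ x, inner ℝ (f x) (w x) = 0) → (Set.univ : Set ℝ).Definable L {v : Fin 6 → ℝ | v 0 ∈ Set.Ico (0 : ℝ) 1 ∧ v 1 ∈ Set.Ico (0 : ℝ) 1 ∧ v 2 ∈ Set.Ico (0 : ℝ) 1 ∧ v 3 = (fun x => -ū x) (Literature.Analysis.FunctionSpaces.Torus.proj !₂[v 0, v 1, v 2]) 0 ∧ v 4 = (fun x => -ū x) (Literature.Analysis.FunctionSpaces.Torus.proj !₂[v 0, v 1, v 2]) 1 ∧ v 5 = (fun x => -ū x) (Literature.Analysis.FunctionSpaces.Torus.proj !₂[v 0, v 1, v 2]) 2} ∧ MeasureTheory.MemLp (fun x => -ū x) 2 MeasureTheory.volume ∧ Literature.Analysis.FunctionSpaces.Torus.IsWeaklyDivFree (fun x => -ū x) ∧ (∀ w : UnitAddTorus (Fin 3)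 → EuclideanSpace ℝ (Fin 3), Literature.Analysis.FunctionSpaces.Torus.IsSmooth w → Literature.Analysis.FunctionSpaces.Torus.IsDivFree w → ∫ x, inner ℝ ((fun x => -ū x) x) (Literature.Analysis.FunctionSpaces.Torus.convect (fun x => -ū x) w x) + ∫ x, inner ℝ (f x) (w x) = 0)

/-- STUB (hardest, open): a tame non-conservative steady weak Euler state exists. -/
theorem stub_nonconservative : Sig.stub_nonconservative := by
  sorry

/-- STUB (true, routine): reflection `ū ↦ −ū` preserves tame steady weak Euler states. -/
theorem stub_reflection : Sig.stub_reflection := by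
  sorry

/-- COMPOSITION (real proof): a non-conservative tame steady Euler state of either sign gives a
tame Euler DISSIPATOR — keep it if it absorbs power, reflect it if it emits power. -/
theorem TameEulerDissipator_of (h₁ : Sig.stub_nonconservative) (h₂ : Sig.stub_reflection) :
    TameEulerDissipator := by
  obtain ⟨f, hf, hdiv, hmean, L, instL, φ, instφ, hO, ū, hdef, hL2, hwdiv, hEuler, hne⟩ := h₁
  rcases lt_or_gt_of_ne hne with hneg | hpos
  · -- the state EMITS power: reflect it
    obtain ⟨hdef', hL2', hwdiv', hEuler'⟩ := @h₂ L instL φ instφ f ū hdef hL2 hwdiv hEuler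
    refine ⟨f, hf, hdiv, hmean, L, instL, φ, instφ, hO, fun x => -ū x, hdef', hL2', hwdiv', hEuler', ?_⟩
    have hflip : ∫ x, inner ℝ (f x) ((fun x => -ū x) x) = -∫ x, inner ℝ (f x) (ū x) := by
      simp only [inner_neg_right, integral_neg]
    rw [hflip]
    linarith
  · exact ⟨f, hf, hdiv, hmean, L, instL, φ, instφ, hO, ū, hdef, hL2, hwdiv, hEuler, hpos⟩

/-- The piece, modulo the two registered stubs. -/
theorem TameEulerDissipator_candidate : TameEulerDissipator :=
  TameEulerDissipator_of stub_nonconservative stub_reflection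

end Summit.AnomalousDissipation.AnomalousDissipation.Cruxes.TameSteadyWitness.BirthTameEulerDissipator

end
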